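import Mathlib
import HarnessLib
import Literature.MathematicalPhysics.QuantumLattice.HubbardModelGrandCanonicalProofs
import Literature.MathematicalPhysics.QuantumLattice.HubbardModelThermodynamicLimitProofs
import Literature.MathematicalPhysics.QuantumLattice.FinDimSpectrumProofs
import Literature.MathematicalPhysics.QuantumLattice.SectorSpectrum

/-!
# Crux `WcbcsBcsConstruction`, line `lro-seed-kink-bridge`: the grand-canonical ground energy is
# the minimum over particle numbers of the sector energies

Support file (`--supports stmt-HubbardSuperconductivity-2010`, registered stub
`stub_gcGroundEnergyEqMin`). For the grand-canonical Hubbard Hamiltonian `K = H(t,U) - μN`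
(`hamiltonianWith G t U μ`) on ANY finite graph `G` on a linearly ordered finite vertex type `Λ`,

  `E₀(K) = min_{0 ≤ N ≤ 2|Λ|} (E(N) - μN)`,

where `E₀ = Matrix.groundEnergy` (bottom of the spectrum of the Hermitian matrix `K`) and
`E(N) = groundEnergyAt G t U N` is the wave-0 sector energy (infimum of `Re ⟨ψ, H ψ⟩` over unit
`N`-particle vectors). Proof (Lieb, PRL 62 (1989) 1201, §2; folklore):

* `≤`: every unit `N`-particle vector `ψ` is a trial vector for `K`, and
  `⟨ψ, Kψ⟩ = ⟨ψ, Hψ⟩ - μN` (`N̂ψ = Nψ`), so `E₀(K) + μN` is a lower bound of the (nonempty, since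
  `N ≤ 2|Λ| = |Orb Λ|`) variational set defining `E(N)`;
* `≥`: `K` commutes with `N̂ = diag(#s)`, hence has no matrix entries between occupation basis
  states of different cardinality; so the restriction of a ground vector `v` of `K` to a sector
  `#s = n` in which `v` has a nonzero coefficient is again an eigenvector with eigenvalue `E₀(K)`;
  normalised, it is a unit `n`-particle vector with `⟨φ, Hφ⟩ = E₀(K) + μn`, whence
  `E(n) - μn ≤ E₀(K)`.

No definitions; everything is proved.
-/

set_option linter.dupNamespace false

namespace Summit.HubbardSuperconductivity.HubbardSuperconductivity.Theorems

open Literature.MathematicalPhysics.QuantumLattice Literature.Probability.LatticeModels Matrix Filter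
open scoped Matrix.Norms.L2Operator ComplexOrder Topology

namespace WcbcsGcGroundEnergy

variable {Λ : Type*} [LinearOrder Λ] [Fintype Λ]

/-- **Particle-number conservation in the occupation basis.** An operator commuting with the
total number operator `N̂ = diag(#s)` has no matrix entries between basis states of different
cardinality. [folklore] -/
-- adapted from `LiebMattis.apply_eq_zero_of_commute_diagonal` (LiebMattisMatrixElements.lean)
theorem apply_eq_zero_of_card_ne {K : Matrix (Finset (Orb Λ)) (Finset (Orb Λ)) ℂ}
    (hK : Commute K totalNumber) {s u : Finset (Orb Λ)} (hsu : s.card ≠ u.card) : K s u = 0 := by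
  rw [← totalNumberOp_eq_totalNumber, totalNumberOp_eq_diagonal] at hK
  have h1 := congrFun (congrFun hK.eq s) u
  rw [mul_diagonal, diagonal_mul] at h1
  have h2 : ((u.card : ℂ) - s.card) * K s u = 0 := by linear_combination h1
  rcases mul_eq_zero.1 h2 with h3 | h3
  · exact absurd (by exact_mod_cast (sub_eq_zero.1 h3).symm) hsu
  · exact h3

/-- A number-conserving operator commutes with the restriction to a particle-number sector:
`K (v|_{#s = n}) = (K v)|_{#s = n}`. [folklore] -/
theorem mulVec_sectorRestrict {K : Matrix (Finset (Orb Λ)) (Finset (Orb Λ)) ℂ}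
    (hK : Commute K totalNumber) (v : Fock (Orb Λ)) (n : ℕ) :
    K *ᵥ (fun s => if s.card = n then v s else 0) =
      fun s => if s.card = n then (K *ᵥ v) s else 0 := by
  funext s
  simp only [mulVec, dotProduct]
  by_cases hs : s.card = n
  · rw [if_pos hs]
    refine Finset.sum_congr rfl fun u _ => ?_
    by_cases hu : u.card = n
    · rw [if_pos hu]
    · have hsu : s.card ≠ u.card := fun h => hu (h ▸ hs)
      rw [if_neg hu, apply_eq_zero_of_card_ne hK hsu, mul_zero, zero_mul]
  · rw [if_neg hs]
    refine Finset.sum_eq_zero fun u _ => ?_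
    by_cases hu : u.card = n
    · have hsu : s.card ≠ u.card := fun h => hs (h.trans hu)
      rw [apply_eq_zero_of_card_ne hK hsu, zero_mul]
    · rw [if_neg hu, mul_zero]

/-- The Rayleigh quotient of `H(t,U) - μN` at an `N`-particle vector:
`⟨ψ, (H - μN̂) ψ⟩ = ⟨ψ, Hψ⟩ - μ N ⟨ψ, ψ⟩`. [folklore] -/
theorem star_dotProduct_hamiltonianWith_mulVec (G : SimpleGraph Λ) [DecidableRel G.Adj]
    (t U μ : ℝ) {N : ℕ} {ψ : Fock (Orb Λ)} (hψ : IsNParticle N ψ) :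
    star ψ ⬝ᵥ hamiltonianWith G t U μ *ᵥ ψ =
      expect (hamiltonian G t U) ψ - (μ : ℂ) * (N : ℂ) * (star ψ ⬝ᵥ ψ) := by
  rw [hamiltonianWith_eq, sub_mulVec, smul_mulVec, totalNumber_mulVec_of_isNParticle hψ,
    dotProduct_sub, dotProduct_smul, dotProduct_smul, expect, smul_smul, smul_eq_mul]

/-- `≤`: the grand-canonical ground energy is below every sector energy,
`E₀(H - μN) ≤ E(N) - μN` for `N ≤ 2|Λ|` (unit `N`-particle vectors are trial vectors; the
sector is nonempty). Lieb, PRL 62 (1989) 1201, §2. [folklore] -/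
theorem groundEnergy_le_groundEnergyAt_sub (G : SimpleGraph Λ) [DecidableRel G.Adj] (t U μ : ℝ)
    {N : ℕ} (hN : N ≤ 2 * Fintype.card Λ) :
    (hamiltonianWith G t U μ).groundEnergy ≤ groundEnergyAt G t U N - μ * N := by
  have hK := isHermitian_hamiltonianWith G t U μ
  have hN' : N ≤ Fintype.card (Orb Λ) := by rwa [card_orb]
  rw [le_sub_iff_add_le]
  unfold groundEnergyAt Literature.MathematicalPhysics.QuantumLattice.groundEnergy
  refine le_csInf (ThermodynamicLimit.groundEnergySet_nonempty (hamiltonian G t U) hN') ?_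
  rintro E ⟨ψ, hψN, hψ1, rfl⟩
  have h1 := Matrix.groundEnergy_le_rayleigh_holds hK ψ hψ1
  rw [star_dotProduct_hamiltonianWith_mulVec G t U μ hψN, hψ1, mul_one] at h1
  simp only [Complex.sub_re, Complex.mul_re, Complex.ofReal_re, Complex.natCast_re,
    Complex.ofReal_im, Complex.natCast_im, mul_zero, sub_zero] at h1
  linarith

/-- `≥`: some sector energy is below the grand-canonical ground energy — the restriction of a
ground vector of `H - μN` to a particle-number sector where it does not vanish is a sector
eigenvector with the same eigenvalue. Lieb, PRL 62 (1989) 1201, §2. [folklore] -/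
theorem iInf_le_groundEnergy (G : SimpleGraph Λ) [DecidableRel G.Adj] (t U μ : ℝ) :
    ⨅ N : Fin (2 * Fintype.card Λ + 1), (groundEnergyAt G t U (N : ℕ) - μ * ((N : ℕ) : ℝ)) ≤
      (hamiltonianWith G t U μ).groundEnergy := by
  have hK : (hamiltonianWith G t U μ).IsHermitian := isHermitian_hamiltonianWith G t U μ
  have hcomm : Commute (hamiltonianWith G t U μ) totalNumber :=
    hamiltonianWith_commute_totalNumber G t U μ
  -- a ground vector and a nonzero coefficient of it
  obtain ⟨v, hv, hv0⟩ := (Submodule.ne_bot_iff _).1 (Matrix.groundSpace_ne_bot_holds hK)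
  rw [Matrix.mem_groundSpace_iff] at hv
  obtain ⟨s₀, hs₀⟩ := Function.ne_iff.1 hv0
  rw [Pi.zero_apply] at hs₀
  have hnle : s₀.card ≤ 2 * Fintype.card Λ := by rw [← card_orb]; exact s₀.card_le_univ
  -- the sector component of the ground vector is a ground vector in the sector
  obtain ⟨w, hw⟩ : ∃ w : Fock (Orb Λ), w = fun s => if s.card = s₀.card then v s else 0 := ⟨_, rfl⟩
  have hw0 : w ≠ 0 := by
    intro h
    have h' := congrFun h s₀
    simp only [hw, Pi.zero_apply, if_pos rfl] at h'
    exact hs₀ h'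
  have hwN : IsNParticle s₀.card w := fun s hs => by simp only [hw, if_neg hs]
  have hKw : hamiltonianWith G t U μ *ᵥ w = ((hamiltonianWith G t U μ).groundEnergy : ℂ) • w := by
    rw [hw, mulVec_sectorRestrict hcomm, hv]
    funext s
    simp only [Pi.smul_apply, smul_eq_mul]
    split_ifs <;> simp
  -- normalise it
  obtain ⟨c, -, hc1⟩ := exists_smul_unit hw0
  have hφN : IsNParticle s₀.card (c • w) := (nParticleSubmodule s₀.card).smul_mem c hwN
  have hKφ : hamiltonianWith G t U μ *ᵥ (c • w) =
      ((hamiltonianWith G t U μ).groundEnergy : ℂ) • (c • w) := by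
    rw [mulVec_smul, hKw, smul_comm]
  -- its energy
  have hE : groundEnergyAt G t U s₀.card - μ * s₀.card ≤ (hamiltonianWith G t U μ).groundEnergy := by
    have h1 := ThermodynamicLimit.groundEnergy_le_re_expect (hamiltonian G t U) hφN hc1
    have h2 : expect (hamiltonian G t U) (c • w) =
        ((hamiltonianWith G t U μ).groundEnergy : ℂ) + (μ : ℂ) * (s₀.card : ℂ) := by
      have h3 := star_dotProduct_hamiltonianWith_mulVec G t U μ hφN
      rw [hKφ, dotProduct_smul, hc1, smul_eq_mul, mul_one, mul_one] at h3
      rw [← sub_eq_iff_eq_add, ← h3]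
    rw [h2] at h1
    simp only [Complex.add_re, Complex.mul_re, Complex.ofReal_re, Complex.natCast_re,
      Complex.ofReal_im, Complex.natCast_im, mul_zero, sub_zero] at h1
    unfold groundEnergyAt
    linarith
  exact (ciInf_le (Set.finite_range _).bddBelow
    (⟨s₀.card, Nat.lt_succ_of_le hnle⟩ : Fin (2 * Fintype.card Λ + 1))).trans hE

end WcbcsGcGroundEnergy

/-- **The grand-canonical ground energy is the minimum over particle numbers of the sector
energies** (registered stub `stub_gcGroundEnergyEqMin` of the line `lro-seed-kink-bridge`): for
the Hubbard Hamiltonian `H(t,U) - μN` on any finite graph,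
`E₀(H(t,U) - μN) = min_{0 ≤ N ≤ 2|Λ|} (E(N) - μN)` with `E(N) = groundEnergyAt G t U N` the wave-0
sector energy (`[H, N] = 0`: a ground vector restricts to sector eigenvectors; conversely unit
sector vectors are trial vectors). Lieb, PRL 62 (1989) 1201, §2. [folklore] -/
theorem stub_gcGroundEnergyEqMin :
    ∀ {Λ : Type} [LinearOrder Λ] [Fintype Λ] (G : SimpleGraph Λ) [DecidableRel G.Adj] (t U μ : ℝ),
      (hamiltonianWith G t U μ).groundEnergy =
        ⨅ N : Fin (2 * Fintype.card Λ + 1), (groundEnergyAt G t U (N : ℕ) - μ * ((N : ℕ) : ℝ)) := by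
  intro Λ _ _ G _ t U μ
  refine le_antisymm (le_ciInf fun N => ?_) (WcbcsGcGroundEnergy.iInf_le_groundEnergy G t U μ)
  exact WcbcsGcGroundEnergy.groundEnergy_le_groundEnergyAt_sub G t U μ (Nat.lt_succ_iff.mp N.isLt)

end Summit.HubbardSuperconductivity.HubbardSuperconductivity.Theorems
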